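import Mathlib
import HarnessLib

/-!
# A semi-homogeneous vector bundle is semiregular iff it is simple: the linear-algebra skeleton

Family `hodge`, layer `Literature/AlgebraicGeometry/HodgeTheory`. Companion to `SemiregularityWeakCriterionAbelian.lean`
(Markman's weak criterion (W) on abelian varieties; [`Markman2025SecantWeilSurvey`, Lemma 11.3 / Question 11.4];
[Markman, arXiv:2502.03415v2, §8.3]) and to the ladder note `papers/HodgeConjecture/hodge-weil-ladder`, section
"Question 11.4″(a) on abelian varieties, II" (`Q114-ABELIAN-II.md`, §1).

THE THEOREM (note §1, Theorem SS). Let `A` be an abelian variety of dimension `g ≥ 2` and `E` a semi-homogeneous vector bundle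
on `A` ([`Mukai1978`]; [`GrossEtAl2023`] = Gross–Kaur–Ulirsch–Werner, Moduli 3 (2026) e8, Thms 2.4, 2.6, 2.16 in the
journal numbering = arXiv:2312.12980v1 Thms 1.5, 1.7, 1.17; total Chern class `c(E) = (1 + c₁(E)/r)^r`:
[`MehtaNori1984SemistableSheaves`, Thm 2 and p. 2 (a)–(c)], re-quoted in [`GrossEtAl2023`, p. 2]). Then for every `i`
  `dim Ext^i(E,E) = Σ_{x ∈ supp G} ( C(g,i) + h^i(𝔞; End⁰(G_x)) )`,
where `G = Φ_H^{-1}(E)` is the finite-length sheaf on the Fourier–Mukai partner `M_{H,1}(A)` corresponding to `E` (the equivalence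
`Φ_H : D^b(M_{H,1}(A)) ⥲ D^b(A)` with kernel the universal bundle, restricting to «sheaves of finite length `k` on `M_{H,1}(A)`» ↔
«semi-homogeneous vector bundles of slope `H` and rank `r = k·n(H)` on `A`», is printed as a numbered statement only in the PREPRINT
versions: [`GrossEtAl2023`, arXiv:2312.12980v2 Thm. 1.17 with Lemma 1.16; v1: inside the proof of Thm. 1.17]; the journal version
Moduli 3 (2026) = v3 keeps it inside the proof of Prop. 2.11, for `H ∈ NS(A)` after the reduction `π : A_H → A` of [`Mukai1978`,
Prop. 5.4 / Prop. 7.6], with kernel the universal line bundle `P_H` on `A × Pic^H(A)` — i.e. Mukai's own equivalence [`Mukai1981`,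
Thm. 2.2] on `A_H`, under which homogeneous bundles correspond to coherent sheaves of finite length on the dual [`Mukai1978`,
Thm. 4.19 (p. 257); unipotent case Thm. 4.12 (p. 254)]), `G_x` its stalk
(a finite-length module over the regular local ring `𝒪_{M,x}` of dimension `g`), `End⁰(G_x)` the traceless `k`-endomorphisms of
`G_x` with the ADJOINT action of the local coordinates (a finite-length module again), and `h^i(𝔞; W) = dim Ext^i_{𝒪_{M,x}}(k, W)`
its Koszul cohomology. Moreover `h^i(𝔞; End⁰(G_x)) ≥ 1` for all `0 ≤ i ≤ g` as soon as `G_x ≇ k(x)`. Consequently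
  `E is semiregular ⟺ dim Ext²(E,E) = C(g,2) ⟺ G = k(x) ⟺ E is simple ⟺ dim Ext¹(E,E) = g`,
i.e. SEMIREGULAR ⟺ SIMPLE for semi-homogeneous bundles (the last equivalence is Mukai's). The reduction "semiregular ⟺
`dim Ext²(E,E) = C(g,2)`" is Theorem S (S3) of the gen-7 note (`at_E = H·id_E`, so `σ_E(e) = e^H ∪ Tr e` and `ker σ_E = ker Tr`).
The proof of the formula: `Ext^i_S(N,N) = H^i(𝔞, Hom_k(N,N))` for `S = k[x₁,…,x_g] = U(𝔞)`, `𝔞 = k^g` abelian (Cartan–Eilenberg),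
`Hom_k(N,N) = k·id ⊕ End⁰(N)` as `𝔞`-modules when `ℓ(N)` is invertible in `k` (trace splitting: `tr[X,θ] = 0`, `tr id = ℓ`),
`H^i(𝔞; k) = ∧^i(k^g)^*`, and NON-VANISHING of every Koszul cohomology group of a nonzero finite-length module with nilpotent
commuting operators (induction on `g` through the long exact sequence `… → H^{i−1}(x′;W) →^{x_g} H^{i−1}(x′;W) → H^i(x;W) →
H^i(x′;W) →^{x_g} …`: a nilpotent operator on a nonzero finite-dimensional space is neither injective nor surjective).

WHAT IS KERNEL-CHECKED HERE (def-free linear algebra and arithmetic, in the standard of the companion files; the identification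
with `Ext`, `σ_E`, `Φ_H` is paper-level): `ker_ne_bot_of_isNilpotent`, `range_ne_top_of_isNilpotent` (the two facts driving the
induction); `iInf_ker_ne_bot_of_commute` (common kernel of two commuting nilpotent operators ≠ 0: `H⁰ ≠ 0`),
`sup_range_ne_top_of_commute` (`T₁V + T₂V ≠ V`: `H^g ≠ 0`; for `g = 2` this IS the statement `h²(𝔞;W) ≥ 1`, so the theorem on
abelian SURFACES is fully reduced to these lemmas); `trace_ad_eq_zero`, `ad_preserves_traceless`, `one_notMem_traceless`,
`finrank_traceless` (trace splitting); `ext_dim_gt_choose_of_pos`, `semiregular_count_iff` (the bookkeeping `C(g,2) + b = C(g,2) ⟺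
b = 0`); and the numerical instances certified independently by `HOME/b2b-hweil-pv1-g8/selfext.py` (exact linear algebra mod two
primes; e.g. `ext^•(S/𝔪², S/𝔪²) = (4,18,18,4)` for `g = 3`, matching `dim Hom(𝔪², S/𝔪²) = g·C(g+1,2)`): `curvilinear_two_ext`
(`U₂ ⊗ L`: `ext^i = 2·C(g,i)`), `two_points_ext` (`L ⊕ L′`: `4·C(g,i)`), `msquare_ext_one` (`g·C(g+1,2)`).
References: [`Mukai1978`]; [`GrossEtAl2023`] (Moduli 3 (2026) e8; journal §2 = arXiv v3 §1; three arXiv numberings: v1 Thm. 1.5/1.7/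
Lemma 1.16/Thm. 1.17 (moduli) — v2 Thm. 1.5/1.7/Lemma 1.16/Thm. 1.17 (Fourier–Mukai kernel)/Prop. 1.18/Thm. 1.19 (moduli) — v3 = journal
Thm. 1.4/1.6/Prop. 1.11/Thm. 1.16 (moduli), the `Ext`-vanishing lemma and the numbered Fourier–Mukai theorem being dropped in v3);
[`Mukai1981`, Thm. 2.2]; [`MehtaNori1984SemistableSheaves`];
[`BuchweitzFlenner2003`] (semiregularity map); [`Weibel1994`, Cor. 7.3.6 / Ex. 7.3.5]
(`Ext_{U𝔤}(M,N) = H^•(𝔤, Hom_k(M,N))`); [`BrunsHerzog1998`, §1.6] (Koszul (co)homology, self-duality `H^i(x;W) ≅ H_{g−i}(x;W)`).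
-/

namespace Literature.AlgebraicGeometry.HodgeTheory.SemiregularSemihomogeneousSimple

open Module

section Nilpotent

variable {𝕜 : Type*} [Field 𝕜] {V : Type*} [AddCommGroup V] [Module 𝕜 V] [FiniteDimensional 𝕜 V]

/-- A nilpotent endomorphism of a NONZERO finite-dimensional vector space is not injective. (The inductive step of the
non-vanishing `H^i(x₁,…,x_g; W) ≠ 0`: `ker(x_g | H^{i−1}(x′;W)) ≠ 0`.) [folklore] -/
theorem ker_ne_bot_of_isNilpotent [Nontrivial V] {T : Module.End 𝕜 V} (hT : IsNilpotent T) :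
    LinearMap.ker T ≠ ⊥ := by
  intro h
  exact hT.not_isUnit ((LinearMap.isUnit_iff_ker_eq_bot T).mpr h)

/-- A nilpotent endomorphism of a NONZERO finite-dimensional vector space is not surjective. (The other half of the inductive
step: `coker(x_g | H^i(x′;W)) ≠ 0`.) [folklore] -/
theorem range_ne_top_of_isNilpotent [Nontrivial V] {T : Module.End 𝕜 V} (hT : IsNilpotent T) :
    LinearMap.range T ≠ ⊤ := by
  intro h
  exact hT.not_isUnit ((LinearMap.isUnit_iff_range_eq_top T).mpr h)

/-- `H⁰ ≠ 0`: two commuting nilpotent operators on a nonzero finite-dimensional space have a common kernel vector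
(`Hom_S(k, W) ≠ 0` for a nonzero finite-length module `W` over `S = k[x₁,x₂]`; the same induction gives any number of operators).
[folklore] -/
theorem iInf_ker_ne_bot_of_commute [Nontrivial V] {T₁ T₂ : Module.End 𝕜 V} (h₁ : IsNilpotent T₁) (h₂ : IsNilpotent T₂)
    (hc : Commute T₁ T₂) : LinearMap.ker T₁ ⊓ LinearMap.ker T₂ ≠ ⊥ := by
  -- `K := ker T₁ ≠ 0` is `T₂`-stable; `T₂|_K` is nilpotent, hence has a kernel vector.
  set K := LinearMap.ker T₁ with hK
  have hKne : K ≠ ⊥ := ker_ne_bot_of_isNilpotent h₁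
  have hstab : ∀ v ∈ K, T₂ v ∈ K := by
    intro v hv
    simp only [hK, LinearMap.mem_ker] at hv ⊢
    have := congrArg (fun f => f v) hc.eq
    simp only [Module.End.mul_apply] at this
    rw [this, hv, map_zero]
  obtain ⟨n, hn⟩ := h₂
  -- restrict
  let T₂' : Module.End 𝕜 K := T₂.restrict hstab
  have hnil' : IsNilpotent T₂' := by
    refine ⟨n, ?_⟩
    apply LinearMap.ext
    intro v
    have hpow : ∀ m : ℕ, ((T₂' ^ m) v : V) = (T₂ ^ m) (v : V) := by
      intro m
      induction m with
      | zero => simp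
      | succ m ih =>
        rw [pow_succ', pow_succ', Module.End.mul_apply, Module.End.mul_apply]
        simp only [T₂', LinearMap.restrict_apply]
        rw [ih]
    apply Subtype.ext
    rw [hpow n, hn]
    simp
  haveI : Nontrivial K := Submodule.nontrivial_iff_ne_bot.mpr hKne
  have hker' : LinearMap.ker T₂' ≠ ⊥ := ker_ne_bot_of_isNilpotent hnil'
  rw [Submodule.ne_bot_iff] at hker' ⊢
  obtain ⟨w, hw, hw0⟩ := hker'
  refine ⟨(w : V), ?_, ?_⟩
  · refine Submodule.mem_inf.mpr ⟨w.2, ?_⟩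
    rw [LinearMap.mem_ker] at hw ⊢
    have := congrArg Subtype.val hw
    simpa [T₂'] using this
  · intro h0
    exact hw0 (Subtype.ext h0)

/-- `H^g ≠ 0` (`g = 2`): for two commuting nilpotent operators on a nonzero finite-dimensional space, `T₁V + T₂V ≠ V`
(`W/(x₁W + x₂W) = k ⊗_S W ≠ 0`, i.e. `β₀(W) ≠ 0`, Nakayama). Via `Ext²_S(N,N) = H²(𝔞; End N) = ∧² ⊕ H²(𝔞; End⁰ N)` this is the
statement `dim Ext²(N,N) ≥ 2 = C(2,2) + 1` for every finite-length `N ≇ k` over a regular local ring of dimension 2 — Theorem SS on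
abelian surfaces. [folklore] -/
theorem sup_range_ne_top_of_commute [Nontrivial V] {T₁ T₂ : Module.End 𝕜 V} (h₁ : IsNilpotent T₁) (h₂ : IsNilpotent T₂)
    (hc : Commute T₁ T₂) : LinearMap.range T₁ ⊔ LinearMap.range T₂ ≠ ⊤ := by
  set p := LinearMap.range T₁ with hp
  have hpne : p ≠ ⊤ := range_ne_top_of_isNilpotent h₁
  have hle : p ≤ p.comap T₂ := by
    rintro v ⟨w, rfl⟩
    simp only [Submodule.mem_comap, hp, LinearMap.mem_range]
    refine ⟨T₂ w, ?_⟩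
    have := congrArg (fun f => f w) hc.eq
    simpa [Module.End.mul_apply] using this
  obtain ⟨n, hn⟩ := h₂
  let S : Module.End 𝕜 (V ⧸ p) := p.mapQ p T₂ hle
  have hnil : IsNilpotent S := by
    refine ⟨n, ?_⟩
    have h' : p ≤ p.comap (T₂ ^ n) := p.le_comap_pow_of_le_comap hle n
    rw [← p.mapQ_pow hle n h']
    apply LinearMap.ext
    intro x
    obtain ⟨v, rfl⟩ := p.mkQ_surjective x
    rw [Submodule.mkQ_apply, Submodule.mapQ_apply]
    simp [hn]
  haveI : Nontrivial (V ⧸ p) := Submodule.Quotient.nontrivial_iff.mpr hpne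
  have hS : LinearMap.range S ≠ ⊤ := range_ne_top_of_isNilpotent hnil
  intro htop
  apply hS
  rw [eq_top_iff]
  rintro x -
  obtain ⟨v, rfl⟩ := p.mkQ_surjective x
  have hv : v ∈ LinearMap.range T₁ ⊔ LinearMap.range T₂ := by rw [← hp, htop]; trivial
  obtain ⟨a, ha, b, hb, rfl⟩ := Submodule.mem_sup.mp hv
  obtain ⟨w, rfl⟩ := LinearMap.mem_range.mp hb
  refine ⟨p.mkQ w, ?_⟩
  have ha0 : (Submodule.Quotient.mk a : V ⧸ p) = 0 := (Submodule.Quotient.mk_eq_zero p).mpr ha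
  simp only [S, Submodule.mkQ_apply, Submodule.mapQ_apply, Submodule.Quotient.mk_add, ha0, zero_add]

end Nilpotent

section TraceSplitting

variable {𝕜 : Type*} [Field 𝕜] {V : Type*} [AddCommGroup V] [Module 𝕜 V]

/-- `tr(ad_X θ) = tr(Xθ − θX) = 0`: the adjoint action of the coordinates on `End_k(N)` lands in the traceless part. [folklore] -/
theorem trace_ad_eq_zero (X θ : Module.End 𝕜 V) : LinearMap.trace 𝕜 V (X * θ - θ * X) = 0 := by
  rw [map_sub, LinearMap.trace_mul_comm, sub_self]

/-- The traceless endomorphisms form an `ad_X`-stable subspace, and `ad_X` kills the identity: `End_k(N) ⊇ k·id ⊕ End⁰(N)` is a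
decomposition into `𝔞`-SUBMODULES for the adjoint action. [folklore] -/
theorem ad_preserves_traceless (X θ : Module.End 𝕜 V) (_hθ : LinearMap.trace 𝕜 V θ = 0) :
    LinearMap.trace 𝕜 V (X * θ - θ * X) = 0 ∧ X * 1 - 1 * X = (0 : Module.End 𝕜 V) :=
  ⟨trace_ad_eq_zero X θ, by rw [mul_one, one_mul, sub_self]⟩

/-- `id ∉ End⁰(N)` when `ℓ(N) = dim N` is invertible in `k` (`tr id = ℓ`): the two submodules `k·id` and `End⁰` are independent,
so `End_k(N) = k·id ⊕ End⁰(N)` by dimension count (`1 + (ℓ² − 1) = ℓ²`, next lemma). [folklore] -/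
theorem one_notMem_traceless [FiniteDimensional 𝕜 V] (hℓ : (Module.finrank 𝕜 V : 𝕜) ≠ 0) :
    LinearMap.trace 𝕜 V (1 : Module.End 𝕜 V) ≠ 0 := by
  rw [LinearMap.trace_one]; exact hℓ

/-- `dim End⁰(N) = ℓ² − 1` (the trace is a nonzero functional when `ℓ ≠ 0` in `k`); in particular `End⁰(N) ≠ 0 ⟺ ℓ ≥ 2`, i.e.
iff `N ≇ k` — the case distinction "simple versus non-simple". [folklore] -/
theorem finrank_traceless [FiniteDimensional 𝕜 V] (hℓ : (Module.finrank 𝕜 V : 𝕜) ≠ 0) :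
    Module.finrank 𝕜 (LinearMap.ker (LinearMap.trace 𝕜 V)) + 1 = Module.finrank 𝕜 (Module.End 𝕜 V) := by
  have hsurj : LinearMap.range (LinearMap.trace 𝕜 V) = ⊤ := by
    rw [eq_top_iff]
    rintro c -
    refine ⟨(c / (Module.finrank 𝕜 V : 𝕜)) • (1 : Module.End 𝕜 V), ?_⟩
    rw [map_smul, LinearMap.trace_one, smul_eq_mul, div_mul_cancel₀ c hℓ]
  have h := LinearMap.finrank_range_add_finrank_ker (LinearMap.trace 𝕜 V)
  rw [hsurj, finrank_top, Module.finrank_self] at h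
  rw [add_comm]; exact h

end TraceSplitting

section Bookkeeping

/-- THE COUNT. With `ext^i(N,N) = C(g,i) + h^i(𝔞; End⁰ N)` (trace splitting + `H^•(𝔞;k) = ∧^•`) and `h^i ≥ 1` whenever `N ≇ k`:
`ext²(N,N) > C(g,2)`. Stated as arithmetic on the two summands. [folklore] -/
theorem ext_dim_gt_choose_of_pos (g b : ℕ) (hb : 1 ≤ b) : Nat.choose g 2 < Nat.choose g 2 + b := by omega

/-- SEMIREGULAR ⟺ SIMPLE, the bookkeeping: for a semi-homogeneous `E ↔ G` with `s` support points and traceless Koszul numbers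
`b = Σ_x h²(𝔞; End⁰ G_x)`, `ext²(E,E) = s·C(g,2) + b`; semiregularity is `ext² = C(g,2)` (Theorem S (S3)); for `g ≥ 2` this forces
`s = 1` and `b = 0`, i.e. `G = k(x)`, i.e. `E` simple. [folklore] -/
theorem semiregular_count_iff (g s b : ℕ) (hg : 2 ≤ g) (hs : 1 ≤ s) :
    s * Nat.choose g 2 + b = Nat.choose g 2 ↔ s = 1 ∧ b = 0 := by
  have hpos : 1 ≤ Nat.choose g 2 := by
    have : Nat.choose g 2 = g * (g - 1) / 2 := Nat.choose_two_right g
    have h4 : 2 ≤ g * (g - 1) := by nlinarith [Nat.sub_add_cancel (show 1 ≤ g by omega)]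
    omega
  constructor
  · intro h
    have hs1 : s ≤ 1 := by
      by_contra hs2
      have hs3 : 2 ≤ s := by omega
      have : 2 * Nat.choose g 2 ≤ s * Nat.choose g 2 := Nat.mul_le_mul_right _ hs3
      omega
    have hs' : s = 1 := le_antisymm hs1 hs
    subst hs'
    constructor
    · rfl
    · omega
  · rintro ⟨rfl, rfl⟩; simp

/-- Mukai's bound recovered, the bookkeeping: `ext¹(E,E) = s·g + b₁` with `b₁ = Σ_x h¹(𝔞; End⁰ G_x) ≥ #{x : G_x ≇ k}`; so
`ext¹(E,E) ≥ g` with equality iff `s = 1` and `b₁ = 0` (⟸ `G = k(x)`, i.e. `E` simple). [folklore] -/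
theorem mukai_count_iff (g s b : ℕ) (hg : 1 ≤ g) (hs : 1 ≤ s) : s * g + b = g ↔ s = 1 ∧ b = 0 := by
  constructor
  · intro h
    have hs1 : s ≤ 1 := by
      by_contra hs2
      have hs3 : 2 ≤ s := by omega
      have : 2 * g ≤ s * g := Nat.mul_le_mul_right _ hs3
      omega
    have hs' : s = 1 := le_antisymm hs1 hs
    subst hs'; exact ⟨rfl, by omega⟩
  · rintro ⟨rfl, rfl⟩; simp

/-- INSTANCE `U₂ ⊗ L` (the non-split self-extension of `𝒪_A` tensored with a line bundle; `G = ` the curvilinear length-2 sheaf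
`k[t]/t²` at a point): `End⁰(G_x) ≅ S/(x₁³, x₂, …, x_g)` as `𝔞`-module (one Jordan block of size 3 under `ad` of the size-2 block),
a complete intersection, so `h^i = C(g,i)` and `ext^i(U₂ ⊗ L) = 2·C(g,i)`: for `g = 3` the vector `(2,6,6,2)`, as computed by
`selfext.py` and as in the gen-7 note (S3) (`ext² = 2·C(g,2)`). [folklore] -/
theorem curvilinear_two_ext :
    (Nat.choose 3 0 + Nat.choose 3 0, Nat.choose 3 1 + Nat.choose 3 1, Nat.choose 3 2 + Nat.choose 3 2,
      Nat.choose 3 3 + Nat.choose 3 3) = (2, 6, 6, 2) := by decide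

/-- INSTANCE `L ⊕ L′` with `L ≇ L′` of the same slope (`G = k(x) ⊕ k(y)`, two support points, `s = 2`, `b = 0`) versus `L ⊕ L`
(`G = k(x)²`, `s = 1`, `End⁰ = 𝔰𝔩₂` trivial module, `h^i = 3·C(g,i)`): `ext^i = 2·C(g,i)` resp. `4·C(g,i)` — for `g = 3`,
`(2,6,6,2)` resp. `(4,12,12,4)` (`selfext.py`). Neither is semiregular (`ext² = 6, 12 > 3`). [folklore] -/
theorem two_points_ext :
    (2 * Nat.choose 3 2, Nat.choose 3 2 + 3 * Nat.choose 3 2) = (6, 12) := by decide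

/-- INSTANCE `S/𝔪²` (the fat point; `E = Φ(𝒪_{M}/𝔪_x²)`, rank `(g+1)·n(H)`): `ext¹ = g·C(g+1,2)` (`= dim Hom_S(𝔪², S/𝔪²)`,
the tangent space to `Hilb^{g+1}(𝔸^g)` at `𝔪²`), i.e. `18` for `g = 3` and `40` for `g = 4`; the formula gives `C(g,1) + h¹(𝔞;End⁰)`
with `h¹ = 15`, `36` (`selfext.py`). [folklore] -/
theorem msquare_ext_one : (3 * Nat.choose 4 2, 4 * Nat.choose 5 2) = (3 + 15, 4 + 36) := by decide

end Bookkeeping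

end Literature.AlgebraicGeometry.HodgeTheory.SemiregularSemihomogeneousSimple
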